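import Mathlib
import HarnessLib
import Summits.NavierStokesRegularity.NavierStokesRegularity.Theorems.PoloidalWindowDoorPoloidalWindowRigidityKillingJetCompactness
import Summits.NavierStokesRegularity.NavierStokesRegularity.Theorems.PoloidalWindowDoorPoloidalWindowRigidityK2OfLrcSpatial
import Summits.NavierStokesRegularity.NavierStokesRegularity.Theorems.PoloidalWindowDoorPoloidalWindowRigiditySeparatedPressure

/-!
# Route `PoloidalWindowDoor`, crux `PoloidalWindowRigidity` (K2, stmt-NavierStokesRegularity-19708), line «lrc-jet» v2 —
# `stub_lrcSpatial` REDUCED TO A POINTWISE ALL-ORDERS JET STATEMENT AT PINS `∇ₓμ ≠ 0`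

Cell ns-regularity-ideate, seat ns-poloidal-K2-p3 gen 4 (stub-worker under the K2 lead ns-poloidal-K2-p1 g4; file landed
`--supports stmt-NavierStokesRegularity-19708` as a helper).

The registered stub `stub_lrcSpatial` (Lines/lrc_jet.lean v2; `hLRC` of `…K2OfLrcSpatial.nonflatLiouville_of_lrc_spatial`)
is a statement about OPEN SETS `W` of the slab (non-degenerate, shear slope not a function of time alone on any open subset)
concluding a symmetry GERM.  The certificate line (ns-poloidal-K2-cert-1, nsreg-p7 g8) works at ONE POINT with a pinned jet.
This file removes all topology from the stub: it suffices to prove, at every point `(s, y₀)` of the slab where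
(ND) `ω ≠ 0`, `∇_h v₂ ≠ 0`, `∂₂v_h ≠ 0` and (PIN) the spatial derivative of the shear slope `μ_b = ∂₂v_b/∂_b v₂` is
nonzero (for an index `b ∈ {0,1}` with `∂_b v₂ ≠ 0`), the ALL-ORDERS infinitesimal symmetry statement of
`…KillingJetCompactness.lrc_germ_of_killing_jets` (for every `N` a nonzero element of the horizontal Euclidean algebra
kills the `N`-jet of `L_K ω` at `y₀`).

* `exists_pin_of_not_timeOnly` — on a nonempty open non-degenerate `W` whose slope is not time-only on any open subset,
  SOME point carries the pin `D_y μ_b ≠ 0` (else `μ_b(s,·)` is locally constant on balls, the frozen constraint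
  `∂₀v₂ ∂₂v₁ = ∂₁v₂ ∂₂v₀` (`…SeparatedPressure.rotatedGradient_wedge_vorticity_eq_zero`) transfers the ratio to the other
  index, and the slope IS time-only on a product box — contradiction);
* `lrcSpatial_of_pointwise_killing_jets` — **(pointwise all-orders Killing jets at every pinned point) ⇒ `hLRC` of v2**;
* `nonflatLiouville_of_pointwise_killing_jets` — with `stub_tv`'s half supplied as a hypothesis `hTV` (PROVED in the
  tree: K2-p2 g3 `stub_tvLiminf` p525351 ∨ the lead's p519353/p522043), K2's conclusion `¬ IsBackwardSingularPoint v 0`.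

WHAT THIS IS NOT: not a claim about Navier–Stokes regularity, not `stub_lrcSpatial` — a reduction of the registered stub
to the pointwise statement the certificate line attacks (bears_on LADDER-NS N0 via crux K2 = stmt-19708).
-/

noncomputable section

-- the summit and its single sub-problem share the name (CONVENTIONS §1), as in every Theorems file
set_option linter.dupNamespace false

namespace Summit.NavierStokesRegularity.NavierStokesRegularity.Theorems.PoloidalWindowDoorPoloidalWindowRigidityLrcSpatialOfJets

open Set Function Filter Topology Metric
open scoped RealInnerProductSpace InnerProductSpace
open Literature.Analysis Literature.Analysis.FluidPDE
open Summit.NavierStokesRegularity.NavierStokesRegularity.Theorems.LocalSineTubeDoorProfileAlignedWindowRigidityAncient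
open Summit.NavierStokesRegularity.NavierStokesRegularity.Theorems.TubeAlternative.AnalyticPropagation
open Summit.NavierStokesRegularity.NavierStokesRegularity.Theorems.PoloidalWindowDoorPoloidalWindowRigidityKillingJetCompactness
open Summit.NavierStokesRegularity.NavierStokesRegularity.Theorems.PoloidalWindowDoorPoloidalWindowRigidityK2OfLrcSlope
open Summit.NavierStokesRegularity.NavierStokesRegularity.Theorems.PoloidalWindowDoorPoloidalWindowRigidityK2OfLrcSpatial
open Summit.NavierStokesRegularity.NavierStokesRegularity.Theorems.PoloidalWindowDoorPoloidalWindowRigiditySeparatedPressure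

variable {C : ℝ} {v : ℝ → EuclideanSpace ℝ (Fin 3) → EuclideanSpace ℝ (Fin 3)}

/-! ### The frozen constraint as a vanishing minor -/

/-- **The frozen constraint**: for a poloidal profile of the class, `∂₀v₂ · ∂₂v₁ = ∂₁v₂ · ∂₂v₀` pointwise
(`J∇_h v₂ ∥ ω_h`, ns-poloidal-K2-p3 g2's `rotatedGradient_wedge_vorticity_eq_zero`). -/
theorem shear_minor_eq (hrate : HasTypeITimeDecay C v)
    (hcont : ContinuousOn (uncurry v) (Iio (0 : ℝ) ×ˢ univ))
    (hmild : ∀ s t : ℝ, s < t → t < 0 → ∀ x,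
      v t x = UnboundedOperators.heatExtension (v s) (t - s) x - oseenDuhamel 1 s v v t x)
    (hdiv : ∀ t < 0, VectorCalculus.IsDivFree (v t))
    (hpol : ∀ s < 0, ∀ y, ⟪curl (v s) y, EuclideanSpace.single 2 1⟫_ℝ = 0) {s : ℝ} (hs : s < 0)
    (y : EuclideanSpace ℝ (Fin 3)) :
    fderiv ℝ (v s) y (EuclideanSpace.single 0 1) 2 * fderiv ℝ (v s) y (EuclideanSpace.single 2 1) 1 =
      fderiv ℝ (v s) y (EuclideanSpace.single 1 1) 2 * fderiv ℝ (v s) y (EuclideanSpace.single 2 1) 0 := by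
  have h := rotatedGradient_wedge_vorticity_eq_zero hrate hcont hmild hdiv hpol hs y
  rw [curl_apply_zero_eq, curl_apply_one_eq] at h
  linear_combination h

/-! ### A pinned point exists on every admissible open set -/

/-- **On an admissible `W` some point carries the pin.**  Let `W` be a nonempty open subset of the slab on which
`∇_h v₂ ≠ 0` pointwise and on which the shear slope is not a function of time alone on any nonempty open subset.  Then
at some `z = (s, y₀) ∈ W` and for some `b ∈ {0,1}` with `∂_b v₂(z) ≠ 0`, the spatial derivative of
`μ_b(s,·) = ∂₂v_b(s,·)/∂_b v₂(s,·)` at `y₀` is nonzero. -/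
theorem exists_pin_of_not_timeOnly (hrate : HasTypeITimeDecay C v)
    (hcont : ContinuousOn (uncurry v) (Iio (0 : ℝ) ×ˢ univ))
    (hmild : ∀ s t : ℝ, s < t → t < 0 → ∀ x,
      v t x = UnboundedOperators.heatExtension (v s) (t - s) x - oseenDuhamel 1 s v v t x)
    (hdiv : ∀ t < 0, VectorCalculus.IsDivFree (v t))
    (hpol : ∀ s < 0, ∀ y, ⟪curl (v s) y, EuclideanSpace.single 2 1⟫_ℝ = 0)
    {W : Set (ℝ × EuclideanSpace ℝ (Fin 3))} (hW : IsOpen W) (hWne : W.Nonempty) (hWs : W ⊆ Iio (0 : ℝ) ×ˢ univ)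
    (hnd : ∀ z ∈ W, fderiv ℝ (v z.1) z.2 (EuclideanSpace.single 0 1) 2 ≠ 0 ∨
      fderiv ℝ (v z.1) z.2 (EuclideanSpace.single 1 1) 2 ≠ 0)
    (hnc : ∀ m : ℝ → ℝ, ∀ W₁ : Set (ℝ × EuclideanSpace ℝ (Fin 3)), W₁ ⊆ W → IsOpen W₁ → W₁.Nonempty →
      ∃ z ∈ W₁, ∃ b : Fin 3, b ≠ 2 ∧
        fderiv ℝ (v z.1) z.2 (EuclideanSpace.single 2 1) b ≠ m z.1 * fderiv ℝ (v z.1) z.2 (EuclideanSpace.single b 1) 2) :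
    ∃ z ∈ W, ∃ b : Fin 3, b ≠ 2 ∧ fderiv ℝ (v z.1) z.2 (EuclideanSpace.single b 1) 2 ≠ 0 ∧
      fderiv ℝ (fun y => fderiv ℝ (v z.1) y (EuclideanSpace.single 2 1) b / fderiv ℝ (v z.1) y (EuclideanSpace.single b 1) 2)
        z.2 ≠ 0 := by
  by_contra hcon
  push Not at hcon
  -- hcon : at every point of W and every admissible b, the spatial derivative of μ_b vanishes
  obtain ⟨z₀, hz₀⟩ := hWne
  have hz₀s : z₀.1 < 0 := (mem_prod.1 (hWs hz₀)).1
  -- an index `b₀` with `∂_{b₀} v₂(z₀) ≠ 0`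
  obtain ⟨b₀, hb₀, hb₀ne⟩ : ∃ b₀ : Fin 3, b₀ ≠ 2 ∧ fderiv ℝ (v z₀.1) z₀.2 (EuclideanSpace.single b₀ 1) 2 ≠ 0 := by
    rcases hnd z₀ hz₀ with h | h
    · exact ⟨0, by decide, h⟩
    · exact ⟨1, by decide, h⟩
  -- continuity of the entry on the slab ⇒ a product box inside `W ∩ {∂_{b₀} v₂ ≠ 0}`
  set O : Set (ℝ × EuclideanSpace ℝ (Fin 3)) := Iio (0 : ℝ) ×ˢ univ with hO
  have hOo : IsOpen O := isOpen_Iio.prod isOpen_univ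
  have hent := continuousOn_fderiv_entry hrate hcont hmild b₀ 2
  have hA : ∀ᶠ z in 𝓝 z₀, z ∈ W ∧ fderiv ℝ (v z.1) z.2 (EuclideanSpace.single b₀ 1) 2 ≠ 0 := by
    have h1 : ∀ᶠ z in 𝓝 z₀, z ∈ W := hW.mem_nhds hz₀
    have h2 : ∀ᶠ z in 𝓝 z₀, fderiv ℝ (v z.1) z.2 (EuclideanSpace.single b₀ 1) 2 ≠ 0 :=
      ((hent z₀ (hWs hz₀)).continuousAt (hOo.mem_nhds (hWs hz₀))).eventually_ne hb₀ne
    exact h1.and h2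
  obtain ⟨r, hr, hball⟩ := Metric.eventually_nhds_iff_ball.1 hA
  -- the box `ball s₀ r × ball x₀ r = ball z₀ r`
  have hbox : ∀ s y, dist s z₀.1 < r → dist y z₀.2 < r → (s, y) ∈ ball z₀ r := by
    intro s y hs hy
    rw [mem_ball, Prod.dist_eq]
    exact max_lt hs hy
  -- differentiability of the Jacobian entries of each slice
  have hDd : ∀ s < 0, ∀ (j i : Fin 3), Differentiable ℝ (fun y => fderiv ℝ (v s) y (EuclideanSpace.single j 1) i) := by
    intro s hs j i
    have hA' : AnalyticOnNhd ℝ (v s) univ := analyticOnNhd_slice hcont (bdd_of_hasTypeITimeDecay hrate) hmild hs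
    have hD : AnalyticOnNhd ℝ (fun y => fderiv ℝ (v s) y (EuclideanSpace.single j 1)) univ := fun y hy =>
      ((ContinuousLinearMap.apply ℝ (EuclideanSpace ℝ (Fin 3)) (EuclideanSpace.single j (1 : ℝ))).analyticAt _).comp
        (hA'.fderiv y hy)
    have hDi : AnalyticOnNhd ℝ (fun y => fderiv ℝ (v s) y (EuclideanSpace.single j 1) i) univ := fun y hy =>
      ((EuclideanSpace.proj (𝕜 := ℝ) i).analyticAt _).comp (hD y hy)
    exact fun y => (hDi y (mem_univ y)).differentiableAt
  -- the time-only slope `m(s) = μ_{b₀}(s, x₀)`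
  set μf : ℝ → EuclideanSpace ℝ (Fin 3) → ℝ := fun s y =>
    fderiv ℝ (v s) y (EuclideanSpace.single 2 1) b₀ / fderiv ℝ (v s) y (EuclideanSpace.single b₀ 1) 2 with hμf
  set m : ℝ → ℝ := fun s => μf s z₀.2 with hm
  -- on the box, `μ_{b₀}(s, ·)` is constant in space
  have hconst : ∀ s y, dist s z₀.1 < r → dist y z₀.2 < r → μf s y = m s := by
    intro s y hs hy
    have hs0 : s < 0 := (mem_prod.1 (hWs (hball _ (hbox s z₀.2 hs (by simpa using hr))).1)).1
    -- `μf s` is differentiable on the ball with zero derivative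
    have hdiffB : ∀ y' ∈ ball z₀.2 r, DifferentiableAt ℝ (μf s) y' := by
      intro y' hy'
      have hmem := hball _ (hbox s y' hs (mem_ball.1 hy'))
      have hne' : fderiv ℝ (v s) y' (EuclideanSpace.single b₀ 1) 2 ≠ 0 := by simpa using hmem.2
      have h1 : DifferentiableAt ℝ (fun y => fderiv ℝ (v s) y (EuclideanSpace.single 2 1) b₀) y' := hDd s hs0 2 b₀ y'
      have h2 : DifferentiableAt ℝ (fun y => fderiv ℝ (v s) y (EuclideanSpace.single b₀ 1) 2) y' := hDd s hs0 b₀ 2 y'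
      have h3 : DifferentiableAt ℝ (fun y => fderiv ℝ (v s) y (EuclideanSpace.single 2 1) b₀ *
          (fderiv ℝ (v s) y (EuclideanSpace.single b₀ 1) 2)⁻¹) y' := h1.mul (h2.inv hne')
      simpa only [hμf, div_eq_mul_inv] using h3
    have hzero : ∀ y' ∈ ball z₀.2 r, fderivWithin ℝ (μf s) (ball z₀.2 r) y' = 0 := by
      intro y' hy'
      have hmem := hball _ (hbox s y' hs (mem_ball.1 hy'))
      rw [fderivWithin_of_isOpen isOpen_ball hy']
      have hne' : fderiv ℝ (v s) y' (EuclideanSpace.single b₀ 1) 2 ≠ 0 := by simpa using hmem.2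
      simpa [hμf] using hcon (s, y') hmem.1 b₀ hb₀ hne'
    have h := (convex_ball z₀.2 r).is_const_of_fderivWithin_eq_zero (𝕜 := ℝ) (f := μf s)
      (fun y' hy' => (hdiffB y' hy').differentiableWithinAt) hzero (mem_ball.2 hy) (mem_ball_self hr)
    simpa [hm] using h
  -- hence the slope is time-only on the box
  have hshear : ∀ z ∈ ball z₀ r, ∀ b : Fin 3, b ≠ 2 →
      fderiv ℝ (v z.1) z.2 (EuclideanSpace.single 2 1) b = m z.1 * fderiv ℝ (v z.1) z.2 (EuclideanSpace.single b 1) 2 := by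
    intro z hz b hb
    have hz' : dist z.1 z₀.1 < r ∧ dist z.2 z₀.2 < r := by
      rw [mem_ball, Prod.dist_eq, max_lt_iff] at hz; exact hz
    have hmem := hball z hz
    have hs0 : z.1 < 0 := (mem_prod.1 (hWs hmem.1)).1
    have hμ := hconst z.1 z.2 hz'.1 hz'.2
    -- the pinned index
    have hb₀eq : fderiv ℝ (v z.1) z.2 (EuclideanSpace.single 2 1) b₀ =
        m z.1 * fderiv ℝ (v z.1) z.2 (EuclideanSpace.single b₀ 1) 2 := by
      rw [← hμ, hμf]
      dsimp only
      rw [div_mul_cancel₀ _ hmem.2]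
    -- the other index via the frozen constraint
    have hminor := shear_minor_eq hrate hcont hmild hdiv hpol hs0 z.2
    have hb' : b = 0 ∨ b = 1 := by
      fin_cases b <;> simp at hb ⊢
    have hb₀' : b₀ = 0 ∨ b₀ = 1 := by
      rcases b₀ with ⟨_ | _ | _ | n, hn⟩
      · exact Or.inl rfl
      · exact Or.inr rfl
      · exact absurd rfl hb₀
      · omega
    rcases hb' with rfl | rfl <;> rcases hb₀' with rfl | rfl
    · exact hb₀eq
    · -- b = 0, b₀ = 1: `∂₂v₀ ∂₁v₂ = ∂₀v₂ ∂₂v₁ = ∂₀v₂ (m ∂₁v₂)`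
      have h1 : fderiv ℝ (v z.1) z.2 (EuclideanSpace.single 1 1) 2 * fderiv ℝ (v z.1) z.2 (EuclideanSpace.single 2 1) 0 =
          fderiv ℝ (v z.1) z.2 (EuclideanSpace.single 1 1) 2 *
            (m z.1 * fderiv ℝ (v z.1) z.2 (EuclideanSpace.single 0 1) 2) := by
        rw [← hminor, hb₀eq]; ring
      exact mul_left_cancel₀ hmem.2 h1
    · -- b = 1, b₀ = 0: `∂₀v₂ ∂₂v₁ = ∂₁v₂ ∂₂v₀ = ∂₁v₂ (m ∂₀v₂)`
      have h1 : fderiv ℝ (v z.1) z.2 (EuclideanSpace.single 0 1) 2 * fderiv ℝ (v z.1) z.2 (EuclideanSpace.single 2 1) 1 =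
          fderiv ℝ (v z.1) z.2 (EuclideanSpace.single 0 1) 2 *
            (m z.1 * fderiv ℝ (v z.1) z.2 (EuclideanSpace.single 1 1) 2) := by
        rw [hminor, hb₀eq]; ring
      exact mul_left_cancel₀ hmem.2 h1
    · exact hb₀eq
  -- contradiction with the non-time-only clause on the box
  have hballW : ball z₀ r ⊆ W := fun z hz => (hball z hz).1
  obtain ⟨z, hz, b, hb, hne⟩ := hnc m (ball z₀ r) hballW isOpen_ball ⟨z₀, mem_ball_self hr⟩
  exact hne (hshear z hz b hb)

/-! ### The reduction -/

/-- **`stub_lrcSpatial` ⇐ POINTWISE ALL-ORDERS KILLING JETS AT PINNED POINTS.**  Let `v` be a profile of the route's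
Type-I class, poloidal along `e₃`.  Suppose that at every point `(s, y₀)` of the slab which is non-degenerate
(`ω ≠ 0`, `∇_h v₂ ≠ 0`, `∂₂v_h ≠ 0`) and pinned (`D_y(∂₂v_b/∂_b v₂)(s,·)(y₀) ≠ 0` for some `b ∈ {0,1}` with
`∂_b v₂(s,y₀) ≠ 0`), for every order `N` some nonzero `p ∈ ℝ³` kills the `N`-jet at `y₀` of
`p₀ Dω[e₀] + p₁ Dω[e₁] + p₂ (Dω[J·] − Jω)` (`ω = curl v(s)`).  Then the hypothesis `hLRC` of
`…K2OfLrcSpatial.nonflatLiouville_of_lrc_spatial` (the registered `stub_lrcSpatial` for this `v`) holds. -/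
theorem lrcSpatial_of_pointwise_killing_jets (hrate : HasTypeITimeDecay C v)
    (hcont : ContinuousOn (uncurry v) (Iio (0 : ℝ) ×ˢ univ))
    (hmild : ∀ s t : ℝ, s < t → t < 0 → ∀ x,
      v t x = UnboundedOperators.heatExtension (v s) (t - s) x - oseenDuhamel 1 s v v t x)
    (hdiv : ∀ t < 0, VectorCalculus.IsDivFree (v t))
    (hpol : ∀ s < 0, ∀ y, ⟪curl (v s) y, EuclideanSpace.single 2 1⟫_ℝ = 0)
    (hP : ∀ s < 0, ∀ y₀ : EuclideanSpace ℝ (Fin 3), curl (v s) y₀ ≠ 0 →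
      (fderiv ℝ (v s) y₀ (EuclideanSpace.single 0 1) 2 ≠ 0 ∨ fderiv ℝ (v s) y₀ (EuclideanSpace.single 1 1) 2 ≠ 0) →
      (fderiv ℝ (v s) y₀ (EuclideanSpace.single 2 1) 0 ≠ 0 ∨ fderiv ℝ (v s) y₀ (EuclideanSpace.single 2 1) 1 ≠ 0) →
      (∃ b : Fin 3, b ≠ 2 ∧ fderiv ℝ (v s) y₀ (EuclideanSpace.single b 1) 2 ≠ 0 ∧
        fderiv ℝ (fun y => fderiv ℝ (v s) y (EuclideanSpace.single 2 1) b / fderiv ℝ (v s) y (EuclideanSpace.single b 1) 2)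
          y₀ ≠ 0) →
      ∀ N : ℕ, ∃ p : Fin 3 → ℝ, p ≠ 0 ∧ ∀ n ≤ N,
        p 0 • iteratedFDeriv ℝ n (fun y => fderiv ℝ (curl (v s)) y (EuclideanSpace.single 0 1)) y₀ +
        p 1 • iteratedFDeriv ℝ n (fun y => fderiv ℝ (curl (v s)) y (EuclideanSpace.single 1 1)) y₀ +
        p 2 • iteratedFDeriv ℝ n (fun y => fderiv ℝ (curl (v s)) y (rotGen y) - rotGen (curl (v s) y)) y₀ = 0) :
    ∀ W : Set (ℝ × EuclideanSpace ℝ (Fin 3)), IsOpen W → W.Nonempty → W ⊆ Iio (0 : ℝ) ×ˢ univ →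
      (∀ z ∈ W, curl (v z.1) z.2 ≠ 0 ∧
        (fderiv ℝ (v z.1) z.2 (EuclideanSpace.single 0 1) 2 ≠ 0 ∨ fderiv ℝ (v z.1) z.2 (EuclideanSpace.single 1 1) 2 ≠ 0) ∧
        (fderiv ℝ (v z.1) z.2 (EuclideanSpace.single 2 1) 0 ≠ 0 ∨ fderiv ℝ (v z.1) z.2 (EuclideanSpace.single 2 1) 1 ≠ 0)) →
      (∀ m : ℝ → ℝ, ∀ W₁ : Set (ℝ × EuclideanSpace ℝ (Fin 3)), W₁ ⊆ W → IsOpen W₁ → W₁.Nonempty →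
        ∃ z ∈ W₁, ∃ b : Fin 3, b ≠ 2 ∧
          fderiv ℝ (v z.1) z.2 (EuclideanSpace.single 2 1) b ≠ m z.1 * fderiv ℝ (v z.1) z.2 (EuclideanSpace.single b 1) 2) →
      ∃ s : ℝ, s < 0 ∧ ∃ U : Set (EuclideanSpace ℝ (Fin 3)), IsOpen U ∧ U.Nonempty ∧
        ((∃ e : EuclideanSpace ℝ (Fin 3), e ≠ 0 ∧ ∀ y ∈ U, fderiv ℝ (curl (v s)) y e = 0) ∨
         (∃ c : EuclideanSpace ℝ (Fin 3), ∀ y ∈ U,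
            rotGen (curl (v s) y) = fderiv ℝ (curl (v s)) y (rotGen (y - c)))) := by
  intro W hW hWne hWs hnd hnc
  obtain ⟨z, hz, b, hb, hbne, hpin⟩ := exists_pin_of_not_timeOnly hrate hcont hmild hdiv hpol hW hWne hWs
    (fun z hz => (hnd z hz).2.1) hnc
  have hs : z.1 < 0 := (mem_prod.1 (hWs hz)).1
  have hjet := hP z.1 hs z.2 (hnd z hz).1 (hnd z hz).2.1 (hnd z hz).2.2 ⟨b, hb, hbne, hpin⟩
  obtain ⟨U, hU, hUne, hsym⟩ := lrc_germ_of_killing_jets hrate hcont hmild hs z.2 hjet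
  exact ⟨z.1, hs, U, hU, hUne, hsym⟩

/-- **K2 ⇐ pointwise all-orders Killing jets ∧ (TV).**  Class + poloidal + the pointwise jet hypothesis of
`lrcSpatial_of_pointwise_killing_jets` + the (TV) Liouville half `hTV` (proved in the tree: ns-poloidal-K2-p2 g3's
`stub_tvLiminf`, p525351, together with the lead's zoom-out doors p519353/p522043) ⇒ `¬ IsBackwardSingularPoint v 0`. -/
theorem nonflatLiouville_of_pointwise_killing_jets (hrate : HasTypeITimeDecay C v)
    (hcont : ContinuousOn (uncurry v) (Iio (0 : ℝ) ×ˢ univ))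
    (hmild : ∀ s t : ℝ, s < t → t < 0 → ∀ x,
      v t x = UnboundedOperators.heatExtension (v s) (t - s) x - oseenDuhamel 1 s v v t x)
    (hdiv : ∀ t < 0, VectorCalculus.IsDivFree (v t))
    (hpol : ∀ s < 0, ∀ y, ⟪curl (v s) y, EuclideanSpace.single 2 1⟫_ℝ = 0)
    (hP : ∀ s < 0, ∀ y₀ : EuclideanSpace ℝ (Fin 3), curl (v s) y₀ ≠ 0 →
      (fderiv ℝ (v s) y₀ (EuclideanSpace.single 0 1) 2 ≠ 0 ∨ fderiv ℝ (v s) y₀ (EuclideanSpace.single 1 1) 2 ≠ 0) →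
      (fderiv ℝ (v s) y₀ (EuclideanSpace.single 2 1) 0 ≠ 0 ∨ fderiv ℝ (v s) y₀ (EuclideanSpace.single 2 1) 1 ≠ 0) →
      (∃ b : Fin 3, b ≠ 2 ∧ fderiv ℝ (v s) y₀ (EuclideanSpace.single b 1) 2 ≠ 0 ∧
        fderiv ℝ (fun y => fderiv ℝ (v s) y (EuclideanSpace.single 2 1) b / fderiv ℝ (v s) y (EuclideanSpace.single b 1) 2)
          y₀ ≠ 0) →
      ∀ N : ℕ, ∃ p : Fin 3 → ℝ, p ≠ 0 ∧ ∀ n ≤ N,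
        p 0 • iteratedFDeriv ℝ n (fun y => fderiv ℝ (curl (v s)) y (EuclideanSpace.single 0 1)) y₀ +
        p 1 • iteratedFDeriv ℝ n (fun y => fderiv ℝ (curl (v s)) y (EuclideanSpace.single 1 1)) y₀ +
        p 2 • iteratedFDeriv ℝ n (fun y => fderiv ℝ (curl (v s)) y (rotGen y) - rotGen (curl (v s) y)) y₀ = 0)
    (hTV : ∀ μ : ℝ → ℝ, (∀ s < 0, μ s < 0) → (∀ s < 0, AnalyticAt ℝ μ s) →
      (∃ s₁ s₂ : ℝ, s₁ < 0 ∧ s₂ < 0 ∧ μ s₁ ≠ μ s₂) →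
      (∀ s < 0, ∀ y, ∀ b : Fin 3, b ≠ 2 →
        fderiv ℝ (v s) y (EuclideanSpace.single 2 1) b = μ s * fderiv ℝ (v s) y (EuclideanSpace.single b 1) 2) →
      ¬ IsBackwardSingularPoint v 0) :
    ¬ IsBackwardSingularPoint v 0 :=
  nonflatLiouville_of_lrc_spatial hrate hcont hmild hdiv hpol
    (lrcSpatial_of_pointwise_killing_jets hrate hcont hmild hdiv hpol hP) hTV

end Summit.NavierStokesRegularity.NavierStokesRegularity.Theorems.PoloidalWindowDoorPoloidalWindowRigidityLrcSpatialOfJets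

end
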